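import Mathlib
import Summits.Ventures.PercRepro2.OneEdge
import Summits.Ventures.PercRepro2.KPrimeReduction
import Summits.Ventures.PercRepro2.KPrimeBase
import Summits.Ventures.PercRepro2.KPrimeSure
import Summits.Ventures.PercRepro2.KPrimeEdgeSteps
import Summits.Ventures.PercRepro2.KPrimeVEdge
import Summits.Ventures.PercRepro2.KPrimeVYDict

/-!
# Resolving an edge from the root of `v` into the mark `y` keeps `(K′)` — unconditionally
(blind cell PercRepro2, mine-c g35; `conjectures/MINE-C.md` §44.0)

The `v`-EXPLORATION of `(K′)` (`MINE-C.md` §42, `KPrimeVInduction.lean`) resolves the edges at the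
weight-`1` root of `v`.  This file closes the edge class INTO THE MARK `y`: for an unresolved edge
`e = {x, y}` with `x` in the root of `v`,

  `kprimeHolds_of_update_zero_vy : (K′)(p[e ↦ 0]) → (K′)(p)`.

Mechanism (exact; `MINE-C.md` §44.0, 1,980 random instances, two codes): with `e` pinned OPEN,
`y ↔ v` is sure, so the `(0,1)`-classes, `Y ∩ S` and the `U ∩ Y`-masses are null, and the
remaining world-`1` masses are world-`0` masses of translated events (`KPrimeVYDict.lean`:
`P¹(S) = P⁰(S ∩ Yᶜ)`, `P¹(U ∩ Ω) = P⁰(U ∩ Ω ∩ Yᶜ) + P⁰((0,1))`,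
`P¹(U ∩ X ∩ Ω) = P⁰(U ∩ X ∩ Ω ∩ Yᶜ) + P⁰(B̃) + P⁰((0,1)ᵉ)`, `P¹(N) = P⁰(N ∩ {a₁ ↮ y})`,
`P¹(X ∩ N) = P⁰(X ∩ N ∩ {a₁ ↮ y})`).  The cleared form then satisfies EXACTLY

  `form(p) = (1 − p e) · (form(p[e ↦ 0]; N₀(p), D₀(p)) + p e · P⁰(B̃) · P(N) · P⁰(Y ∩ S))`,

where `form(p⁰; N₀(p), D₀(p))` is the world-`0` form at the PARENT's threshold `E₀(p) ≤ E₀(p⁰)`;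
it is `≥ 0` because the form is affine in the threshold with slope `−(E-slope) ≤ 0` (`slope_ineq`,
BHK06 1.4 in `S`) and the lean drops when `y` joins the avoided set (`lean_drop_ineq`, van den
Berg–Kahn 1.2 for the root `a₁`: `P(X ∩ N ∩ {a₁ ↮ y}) · P(N) ≤ P(X ∩ N) · P(N ∩ {a₁ ↮ y})`).  Together with `kprimeHolds_of_update_zero_va₁` / `_va₂` (`KPrimeVEdge.lean`) three
of the five edge classes of the `v`-exploration are unconditional.
-/

namespace Summit.Ventures.PercRepro2

namespace KPrime

variable {V : Type*} {E : Type*} [Fintype E] [DecidableEq E] [Fintype V] [DecidableEq V]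
  {R : Type*} [Field R] [LinearOrder R] [IsStrictOrderedRing R]

section StepVY

variable {ends : E → Sym2 V} {a₁ a₂ b v y : V} {p : E → R} {e : E}

/-! ### The lean drops when `y` joins the avoided set (van den Berg–Kahn) -/

omit [Fintype E] [DecidableEq E] [Fintype V] [IsStrictOrderedRing R] in
/-- `N ∩ {a₁ ↮ y} = {a₁ ↮ {a₂, v, y}}`. -/
lemma N_inter_compl_eq_avoidAll :
    N ends a₁ a₂ v ∩ (connEvent ends a₁ y)ᶜ = avoidAll ends a₁ {a₂, v, y} := by
  ext ω
  simp only [Set.mem_inter_iff, Set.mem_compl_iff, mem_connEvent, mem_N, mem_avoidAll,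
    Finset.mem_insert, Finset.mem_singleton, forall_eq_or_imp, forall_eq]
  tauto

/-- **The lean drops when `y` joins the avoided set** (van den Berg–Kahn 1.2 for the root `a₁`):
`P(X ∩ N ∩ {a₁ ↮ y}) · P(N) ≤ P(X ∩ N) · P(N ∩ {a₁ ↮ y})`, i.e. `E₀(V ∪ {y}) ≤ E₀(V)`. -/
lemma lean_drop_ineq (hp : IsProbVec p) :
    prob p (connEvent ends a₁ b ∩ N ends a₁ a₂ v ∩ (connEvent ends a₁ y)ᶜ) *
        prob p (N ends a₁ a₂ v) ≤
      prob p (connEvent ends a₁ b ∩ N ends a₁ a₂ v) *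
        prob p (N ends a₁ a₂ v ∩ (connEvent ends a₁ y)ᶜ) := by
  have h := vdBK p hp ends a₁ {b} ∅ {a₂, v, y} {a₂, v}
  have e1 : connAll ends a₁ {b} = connEvent ends a₁ b := by ext ω; simp [connAll]
  have e2 : connAll ends a₁ (∅ : Finset V) = Set.univ := by ext ω; simp [connAll]
  have e3 : connAll ends a₁ ({b} ∪ ∅) = connEvent ends a₁ b := by ext ω; simp [connAll]
  have e5 : ({a₂, v, y} : Finset V) ∩ {a₂, v} = {a₂, v} := by
    ext z; simp only [Finset.mem_inter, Finset.mem_insert, Finset.mem_singleton]; tauto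
  have e6 : ({a₂, v, y} : Finset V) ∪ {a₂, v} = {a₂, v, y} := by
    ext z; simp only [Finset.mem_union, Finset.mem_insert, Finset.mem_singleton]; tauto
  rw [e1, e2, e3, e5, e6, Set.univ_inter, ← N_inter_compl_eq_avoidAll] at h
  have e7 : connEvent ends a₁ b ∩ (N ends a₁ a₂ v ∩ (connEvent ends a₁ y)ᶜ) =
      connEvent ends a₁ b ∩ N ends a₁ a₂ v ∩ (connEvent ends a₁ y)ᶜ := (Set.inter_assoc _ _ _).symm
  rw [e7] at h
  simpa only [N] using h

/-! ### The theorem -/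

omit [Fintype E] [DecidableEq E] [Fintype V] [DecidableEq V] in
/-- **The threshold lemma**: the cleared `(K′)` form `D·α − N·β` is affine in the threshold pair
`(N, D)` with `β ≥ 0` the `E`-slope; if it is `≥ 0` at `(n0, d0)` it is `≥ 0` at every `(N, D)`
with `N/D ≤ n0/d0` (cleared: `N·d0 ≤ n0·D`), because
`d0·(Dα − Nβ) = D·(d0α − n0β) + β·(n0 D − N d0)`. -/
lemma thr_nonneg {α β n0 d0 N D : R} (hβ : 0 ≤ β) (hd0 : 0 ≤ d0) (hN : 0 ≤ N)
    (hDle : D ≤ d0) (hNle : N ≤ D) (hND : N * d0 ≤ n0 * D) (h0 : 0 ≤ d0 * α - n0 * β) :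
    0 ≤ D * α - N * β := by
  rcases hd0.eq_or_lt with h | h
  · have hD0 : D = 0 := le_antisymm (h ▸ hDle) (le_trans hN hNle)
    have hN0 : N = 0 := le_antisymm (hD0 ▸ hNle) hN
    rw [hD0, hN0]; ring_nf; exact le_rfl
  · have key : d0 * (D * α - N * β) = D * (d0 * α - n0 * β) + β * (n0 * D - N * d0) := by ring
    have : 0 ≤ d0 * (D * α - N * β) := by
      rw [key]
      exact add_nonneg (mul_nonneg (le_trans hN hNle) h0) (mul_nonneg hβ (by linarith))
    exact (mul_nonneg_iff_of_pos_left h).1 this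

omit [Fintype E] [DecidableEq E] [Fintype V] [DecidableEq V] in
/-- The algebra of the `v`–`y` step.  With `α := A·Ys + Sm·(Oe − C)`, `β := H·Ys + Sm·(O − D)`
(so that `form(p⁰; n, d) = d·α − n·β`), the parent's form is
`(1 − t)·[(1 − t)·(d0 α − n0 β) + t·(d1 α − n1 β) + t·Bt·(t d1 + (1 − t) d0)·Ys]`; the middle
bracket is `≥ 0` by `thr_nonneg` (`E₀(p¹) ≤ E₀(p⁰)`, `lean_drop_ineq`). -/
lemma vy_form_nonneg {t A H Ys Sm Oe O C D n0 d0 n1 d1 Bt : R} (ht0 : 0 ≤ t) (ht1 : t ≤ 1)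
    (hYs : 0 ≤ Ys) (hBt : 0 ≤ Bt) (hd0 : 0 ≤ d0) (hd1 : 0 ≤ d1) (hn1 : 0 ≤ n1) (hSm : 0 ≤ Sm)
    (hO : 0 ≤ O) (hm1 : d1 ≤ d0) (hm2 : n1 ≤ d1) (hI1 : n1 * d0 ≤ n0 * d1)
    (hI2 : D * Sm ≤ H * Ys)
    (h0 : 0 ≤ (A * d0 - n0 * H) * Ys + Sm * ((Oe * d0 - n0 * O) - (C * d0 - n0 * D))) :
    0 ≤ ((t * (A - C + Bt + Oe) + (1 - t) * A) * (t * d1 + (1 - t) * d0) -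
          (t * n1 + (1 - t) * n0) * (t * (H - D + O) + (1 - t) * H)) * (t * 0 + (1 - t) * Ys) +
        (t * (Sm - Ys) + (1 - t) * Sm) *
          (((t * 0 + (1 - t) * Oe) * (t * d1 + (1 - t) * d0) -
              (t * n1 + (1 - t) * n0) * (t * 0 + (1 - t) * O)) -
            ((t * 0 + (1 - t) * C) * (t * d1 + (1 - t) * d0) -
              (t * n1 + (1 - t) * n0) * (t * 0 + (1 - t) * D))) := by
  have h1t : 0 ≤ 1 - t := sub_nonneg.2 ht1
  have hβ : 0 ≤ H * Ys + Sm * (O - D) := by linarith [mul_nonneg hSm hO]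
  have hQ : 0 ≤ d1 * (A * Ys + Sm * (Oe - C)) - n1 * (H * Ys + Sm * (O - D)) :=
    thr_nonneg hβ hd0 hn1 hm1 hm2 hI1 (by linarith [h0])
  have hD₀ : 0 ≤ t * d1 + (1 - t) * d0 := add_nonneg (mul_nonneg ht0 hd1) (mul_nonneg h1t hd0)
  have e1 := mul_nonneg (mul_nonneg h1t h1t) h0
  have e2 := mul_nonneg (mul_nonneg h1t ht0) hQ
  have e3 := mul_nonneg (mul_nonneg (mul_nonneg (mul_nonneg h1t ht0) hBt) hD₀) hYs
  linarith [e1, e2, e3]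

/-- **Resolving an edge from the root of `v` into the mark `y`**: `(K′)` with the edge pinned
closed gives `(K′)` —
`form(p) = (1 − p e) · (form(p[e ↦ 0]; N₀(p), D₀(p)) + p e · P⁰(B̃) · P(N) · P⁰(Y ∩ S))`, and the
world-`0` form at the parent's threshold is `≥ 0` by `slope_ineq` and `lean_drop_ineq`. -/
theorem kprimeHolds_of_update_zero_vy (hp : IsProbVec p) {x : V} (hends : ends e = s(x, y))
    (hx : x ∈ root p ends v) (he : p e ≠ 1)
    (h0 : KPrimeHolds ends a₁ a₂ b v y (Function.update p e 0)) :
    KPrimeHolds ends a₁ a₂ b v y p := by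
  have hp0 : IsProbVec (Function.update p e 0) := hp.update e le_rfl zero_le_one
  obtain ⟨n1, n2, n3, n4, n5⟩ := null_masses_vy (a₁ := a₁) (a₂ := a₂) (b := b) hends hx he
  have hS1 := prob_S_vy (a₁ := a₁) (a₂ := a₂) hends hx he
  have hN1 := prob_N_vy (a₁ := a₁) (a₂ := a₂) hends hx he
  have hXN1 := prob_XN_vy (a₁ := a₁) (a₂ := a₂) (b := b) hends hx he
  have hH1 := prob_UΩ_vy (a₁ := a₁) (a₂ := a₂) hends hx he
  have hA1 := prob_UXΩ_vy (a₁ := a₁) (a₂ := a₂) (b := b) hends hx he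
  -- world-`0` decompositions along `Y`
  have eS := prob_inter_add_prob_inter_compl (Function.update p e 0) (S ends a₁ a₂ v)
    (connEvent ends a₂ y)
  have eH := prob_inter_add_prob_inter_compl (Function.update p e 0)
    (connEvent ends a₁ v ∩ Ω ends a₁ a₂) (connEvent ends a₂ y)
  have eA := prob_inter_add_prob_inter_compl (Function.update p e 0)
    (connEvent ends a₁ v ∩ connEvent ends a₁ b ∩ Ω ends a₁ a₂) (connEvent ends a₂ y)
  have kS : S ends a₁ a₂ v ∩ connEvent ends a₂ y = connEvent ends a₂ y ∩ S ends a₁ a₂ v :=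
    Set.inter_comm _ _
  have kH : connEvent ends a₁ v ∩ Ω ends a₁ a₂ ∩ connEvent ends a₂ y =
      connEvent ends a₁ v ∩ connEvent ends a₂ y ∩ Ω ends a₁ a₂ := by
    ext ω; simp only [Set.mem_inter_iff]; tauto
  have kA : connEvent ends a₁ v ∩ connEvent ends a₁ b ∩ Ω ends a₁ a₂ ∩ connEvent ends a₂ y =
      connEvent ends a₁ v ∩ connEvent ends a₂ y ∩ connEvent ends a₁ b ∩ Ω ends a₁ a₂ := by
    ext ω; simp only [Set.mem_inter_iff]; tauto
  rw [kS] at eS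
  rw [kH] at eH
  rw [kA] at eA
  have eSc : prob (Function.update p e 0) (S ends a₁ a₂ v ∩ (connEvent ends a₂ y)ᶜ) =
      prob (Function.update p e 0) (S ends a₁ a₂ v) -
        prob (Function.update p e 0) (connEvent ends a₂ y ∩ S ends a₁ a₂ v) := by linarith
  have eHc : prob (Function.update p e 0)
      (connEvent ends a₁ v ∩ Ω ends a₁ a₂ ∩ (connEvent ends a₂ y)ᶜ) =
      prob (Function.update p e 0) (connEvent ends a₁ v ∩ Ω ends a₁ a₂) -
        prob (Function.update p e 0) (connEvent ends a₁ v ∩ connEvent ends a₂ y ∩ Ω ends a₁ a₂) := by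
    linarith
  have eAc : prob (Function.update p e 0)
      (connEvent ends a₁ v ∩ connEvent ends a₁ b ∩ Ω ends a₁ a₂ ∩ (connEvent ends a₂ y)ᶜ) =
      prob (Function.update p e 0) (connEvent ends a₁ v ∩ connEvent ends a₁ b ∩ Ω ends a₁ a₂) -
        prob (Function.update p e 0)
          (connEvent ends a₁ v ∩ connEvent ends a₂ y ∩ connEvent ends a₁ b ∩ Ω ends a₁ a₂) := by
    linarith
  -- the inequalities
  have hI1 := lean_drop_ineq (ends := ends) (a₁ := a₁) (a₂ := a₂) (b := b) (v := v) (y := y) hp0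
  have hI2 := slope_ineq (Function.update p e 0) ends a₁ a₂ v y hp0
  have hm1 : prob (Function.update p e 0) (N ends a₁ a₂ v ∩ (connEvent ends a₁ y)ᶜ) ≤
      prob (Function.update p e 0) (N ends a₁ a₂ v) := prob_mono hp0 Set.inter_subset_left
  have hm2 : prob (Function.update p e 0)
      (connEvent ends a₁ b ∩ N ends a₁ a₂ v ∩ (connEvent ends a₁ y)ᶜ) ≤
      prob (Function.update p e 0) (N ends a₁ a₂ v ∩ (connEvent ends a₁ y)ᶜ) :=
    prob_mono hp0 (Set.inter_subset_inter_left _ Set.inter_subset_right)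
  -- expand the form
  unfold KPrimeHolds kprimeForm at h0 ⊢
  rw [prob_eq_pin p (connEvent ends a₁ v ∩ connEvent ends a₁ b ∩ Ω ends a₁ a₂) e,
    prob_eq_pin p (connEvent ends a₁ b ∩ N ends a₁ a₂ v) e,
    prob_eq_pin p (N ends a₁ a₂ v) e,
    prob_eq_pin p (connEvent ends a₁ v ∩ Ω ends a₁ a₂) e,
    prob_eq_pin p (connEvent ends a₂ y ∩ S ends a₁ a₂ v) e,
    prob_eq_pin p (S ends a₁ a₂ v) e,
    prob_eq_pin p (cls01e ends a₁ a₂ b v y) e,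
    prob_eq_pin p (cls01 ends a₁ a₂ v y) e,
    prob_eq_pin p (connEvent ends a₁ v ∩ connEvent ends a₂ y ∩ connEvent ends a₁ b ∩ Ω ends a₁ a₂) e,
    prob_eq_pin p (connEvent ends a₁ v ∩ connEvent ends a₂ y ∩ Ω ends a₁ a₂) e]
  rw [n1, n2, n3, n4, n5, hS1, hN1, hXN1, hH1, hA1, eSc, eHc, eAc]
  have key := vy_form_nonneg (hp.nonneg e) (hp.le_one e)
    (prob_nonneg hp0 (connEvent ends a₂ y ∩ S ends a₁ a₂ v))
    (prob_nonneg hp0 (connEvent ends a₁ v ∩ Ω ends a₁ a₂ ∩ (connEvent ends a₂ y)ᶜ ∩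
      (connEvent ends a₁ b)ᶜ ∩ connEvent ends b y))
    (prob_nonneg hp0 (N ends a₁ a₂ v))
    (prob_nonneg hp0 (N ends a₁ a₂ v ∩ (connEvent ends a₁ y)ᶜ))
    (prob_nonneg hp0 (connEvent ends a₁ b ∩ N ends a₁ a₂ v ∩ (connEvent ends a₁ y)ᶜ))
    (prob_nonneg hp0 (S ends a₁ a₂ v)) (prob_nonneg hp0 (cls01 ends a₁ a₂ v y)) hm1 hm2 hI1 hI2 h0
  linarith [key]

end StepVY

end KPrime

end Summit.Ventures.PercRepro2
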